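import Summits.Ventures.LatticeQCDFlow.Scaling.TiltedHeatBath

/-!
HONEST FRAMING: exact (Metropolis-corrected) sampling algorithms for lattice gauge theory; figures
of merit are autocorrelation/cost numbers at stated couplings and volumes; no continuum-physics
claim.

# TiltedInnovations — THE ONE-LINK DOMINATION ENGINE, ORTHOGONAL HEAT-BATH INNOVATIONS OF AN
# ARBITRARY OBSERVABLE, BESSEL'S INEQUALITY `Σ_e ∫ (D_e F)² dπ_Φ ≤ Var_{π_Φ}(F)`, AND THE ONE-LINK
# FLOOR (lean-1 GEN-11, ours; part 2 of 5 of the defect specific-heat floor (DVF))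

Venture-side (OURS). Cell `lqcd-flow` (pub-lqcd), unit `pub-lqcd-lean-1-g11`, 2026-08-23.  Sequel of
`TiltedHeatBath` (the measure `π_Φ = e^{Φ} dU / Z`, the heat-bath operator `K_e^Φ`, the innovation
`D_e^Φ F = F − K_e^Φ F`, the Haar fibre variance `Q_e F`).  Item 126's §3–§4
(`ExtensiveSpecificHeatInnovations`) with (Wilson weight, Wilson action) replaced by (`e^{Φ}`, `F`):

* §1 **ENGINE** (`exp_neg_mul_integral_linkAvg_le`): if replacing the link `e` never raises `Φ` by
  more than `C` (`Φ(h ·ₑ U) ≤ Φ(U) + C`), then `e^{−C} ∫ A_e ψ dπ_Φ ≤ ∫ ψ dπ_Φ` for continuous `ψ ≥ 0`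
  (left invariance of `dU` at the link and Fubini: the weight moves by at most `e^{C}`).
* §2 **SEPARATION ⇒ ORTHOGONALITY.**  Say a function `f` SEPARATES the links `e ≠ e'` if
  `f(h' ·_{e'} h ·ₑ U) − f(h' ·_{e'} U) = f(h ·ₑ U) − f(U)` (for plaquette sums: no plaquette contains
  both links).  If `Φ` and `F` separate `e, e'` then `D_{e'}^Φ F` does not depend on the link `e`
  (shift rule), the innovations `D_e^Φ F`, `D_{e'}^Φ F` are `π_Φ`-orthogonal, and for a finite family
  `M` of pairwise separated links **`Σ_{e∈M} ∫ (D_e^Φ F)² dπ_Φ ≤ ∫ (F − a)² dπ_Φ`** for every constant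
  `a` (Bessel), in particular `≤ Var_{π_Φ}(F)` (`sum_integral_innovT_sq_le_variance`).
* §3 the fibre variance is dominated by the fibre mean square of the innovation
  (`sqDevT_le_linkAvg_innovT_sq`), and the **ONE-LINK FLOOR** (`integral_innovT_sq_ge`):
  `e^{−C_e} e^{−C_{e⋆}} ∫ A_{e⋆} Q_e F dπ_Φ ≤ ∫ (D_e^Φ F)² dπ_Φ` for any second link `e⋆`
  (ENGINE at `e`, the fibre bound, ENGINE at `e⋆`).

NOT CLAIMED: anything about a specific action or observable (sequels `PlaquetteSumStaple`,
`DefectVarianceFloor`).  Literature grade (cell rule): known mechanism (Holley 1974 domination;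
Dobrushin–Tirozzi 1977 sublattice conditioning; Bessel's inequality); new typing only.
-/

noncomputable section

namespace Summit.Ventures.LatticeQCDFlow.Theory2.DefectFloor

open MeasureTheory ProbabilityTheory Literature.MathematicalPhysics.QuantumFieldTheory
open Summit.Ventures.LatticeQCDFlow.TrivializingMaps
open Summit.Ventures.LatticeQCDFlow.Theory2.ExtensiveSpecificHeat
open scoped ENNReal

/-! ## §1 ENGINE: one-link Haar resampling is dominated by `π_Φ` -/

section Engine

variable {d L : ℕ} [NeZero L] {G : Type*} [Group G] [TopologicalSpace G] [IsTopologicalGroup G]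
  [CompactSpace G] [MeasurableSpace G] [BorelSpace G] [SecondCountableTopology G]
  [DecidableEq (Edge d L)]

/-- Undoing a link multiplication: `h⁻¹ ·ₑ (h ·ₑ U) = U`. [folklore] -/
theorem mulSingle_inv_mul_mulSingle_mul (e : Edge d L) (h : G) (U : GaugeConfig d L G) :
    Pi.mulSingle e h⁻¹ * (Pi.mulSingle e h * U) = U := by
  rw [mulSingle_mul_mulSingle_mul, inv_mul_cancel, mulSingle_one_mul]

/-- **Weighted form of the ENGINE.** If `Φ(h ·ₑ U) ≤ Φ(U) + C` for all `h, U`, then for continuous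
`ψ ≥ 0`: `∫ e^{Φ} · A_e ψ dU ≤ e^{C} ∫ e^{Φ} ψ dU` (Fubini; left invariance of `dU` under
`U ↦ h ·ₑ U`; the weight moves by at most `e^{C}`). -/
theorem integral_tiltW_mul_linkAvg_le {Φ : GaugeConfig d L G → ℝ} (hΦ : Continuous Φ) (e : Edge d L)
    {C : ℝ} (hC : ∀ (h : G) (U : GaugeConfig d L G), Φ (Pi.mulSingle e h * U) ≤ Φ U + C)
    {ψ : GaugeConfig d L G → ℝ} (hψ : Continuous ψ) (hψ0 : ∀ U, 0 ≤ ψ U) :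
    ∫ U, tiltW Φ U * linkAvg e ψ U ∂(Measure.pi fun _ : Edge d L => haarProbability G)
      ≤ Real.exp C * ∫ U, tiltW Φ U * ψ U ∂(Measure.pi fun _ : Edge d L => haarProbability G) := by
  set π := Measure.pi (fun _ : Edge d L => haarProbability G) with hπ
  have hw : Continuous (tiltW (d := d) (L := L) Φ) := continuous_tiltW hΦ
  -- (i) Fubini: `∫ e^{Φ} A_e ψ dU = ∫ dh ∫ e^{Φ(U)} ψ(h ·ₑ U) dU`
  have hF : Continuous (Function.uncurry fun (U : GaugeConfig d L G) (h : G) =>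
      tiltW Φ U * ψ (Pi.mulSingle e h * U)) :=
    (hw.comp continuous_fst).mul (continuous_comp_mulSingle e hψ)
  have hint : Integrable (Function.uncurry fun (U : GaugeConfig d L G) (h : G) =>
      tiltW Φ U * ψ (Pi.mulSingle e h * U)) (π.prod (haarProbability G)) :=
    hF.integrable_of_hasCompactSupport (HasCompactSupport.of_compactSpace _)
  have h1 : ∫ U, tiltW Φ U * linkAvg e ψ U ∂π
      = ∫ h, ∫ U, tiltW Φ U * ψ (Pi.mulSingle e h * U) ∂π ∂haarProbability G := by
    unfold linkAvg
    simp_rw [← integral_const_mul]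
    exact integral_integral_swap hint
  -- (ii) for each `h`: `∫ e^{Φ(U)} ψ(h ·ₑ U) dU = ∫ e^{Φ(h⁻¹ ·ₑ V)} ψ(V) dV ≤ e^{C} ∫ e^{Φ} ψ dV`
  have h2 : ∀ h : G, ∫ U, tiltW Φ U * ψ (Pi.mulSingle e h * U) ∂π
      ≤ Real.exp C * ∫ U, tiltW Φ U * ψ U ∂π := by
    intro h
    set Gh : GaugeConfig d L G → ℝ := fun V => tiltW Φ (Pi.mulSingle e h⁻¹ * V) * ψ V with hGh
    have hfun : (fun U => tiltW Φ U * ψ (Pi.mulSingle e h * U))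
        = fun U => Gh (Pi.mulSingle e h * U) := by
      funext U
      simp only [hGh, mulSingle_inv_mul_mulSingle_mul]
    rw [hfun, integral_mul_left_eq_self (μ := π) Gh (Pi.mulSingle e h), ← integral_const_mul]
    have hGc : Continuous Gh := (hw.comp (continuous_const.mul continuous_id)).mul hψ
    refine integral_mono (integrable_of_continuous_config hGc)
      ((integrable_of_continuous_config (hw.mul hψ)).const_mul _) fun V => ?_
    have hle : tiltW Φ (Pi.mulSingle e h⁻¹ * V) ≤ Real.exp C * tiltW Φ V := by
      unfold tiltW
      rw [← Real.exp_add]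
      exact Real.exp_le_exp.2 (by linarith [hC h⁻¹ V])
    simp only [hGh]
    rw [← mul_assoc]
    exact mul_le_mul_of_nonneg_right hle (hψ0 V)
  -- (iii) assemble
  have hX : Continuous fun h : G => ∫ U, tiltW Φ U * ψ (Pi.mulSingle e h * U) ∂π := by
    have hF' : Continuous (Function.uncurry fun (h : G) (U : GaugeConfig d L G) =>
        tiltW Φ U * ψ (Pi.mulSingle e h * U)) :=
      (hF.comp continuous_swap).congr fun _ => rfl
    have hc := continuous_parametric_integral_of_continuous (μ := π) hF' isCompact_univ
    simp only [Measure.restrict_univ] at hc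
    exact hc
  rw [h1]
  calc ∫ h, ∫ U, tiltW Φ U * ψ (Pi.mulSingle e h * U) ∂π ∂haarProbability G
      ≤ ∫ _h : G, Real.exp C * ∫ U, tiltW Φ U * ψ U ∂π ∂haarProbability G :=
        integral_mono (integrable_of_continuous_group hX) (integrable_const _) h2
    _ = Real.exp C * ∫ U, tiltW Φ U * ψ U ∂π := by
        rw [integral_const, smul_eq_mul, probReal_univ, one_mul]

/-- **ENGINE.** If `Φ(h ·ₑ U) ≤ Φ(U) + C` for all `h, U` (replacing the link `e` never raises the
log-density by more than `C`), then for every continuous `ψ ≥ 0`: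
`e^{−C} ∫ A_e ψ dπ_Φ ≤ ∫ ψ dπ_Φ`. -/
theorem exp_neg_mul_integral_linkAvg_le {Φ : GaugeConfig d L G → ℝ} (hΦ : Continuous Φ)
    (e : Edge d L) {C : ℝ}
    (hC : ∀ (h : G) (U : GaugeConfig d L G), Φ (Pi.mulSingle e h * U) ≤ Φ U + C)
    {ψ : GaugeConfig d L G → ℝ} (hψ : Continuous ψ) (hψ0 : ∀ U, 0 ≤ ψ U) :
    Real.exp (-C) * ∫ U, linkAvg e ψ U ∂haarTilt Φ ≤ ∫ U, ψ U ∂haarTilt Φ := by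
  refine integral_haarTilt_le_of_weighted hΦ ?_
  have h := integral_tiltW_mul_linkAvg_le hΦ e hC hψ hψ0
  have hc : 0 < Real.exp (-C) := Real.exp_pos _
  calc Real.exp (-C) * ∫ U, tiltW Φ U * linkAvg e ψ U
        ∂(Measure.pi fun _ : Edge d L => haarProbability G)
      ≤ Real.exp (-C) * (Real.exp C * ∫ U, tiltW Φ U * ψ U
          ∂(Measure.pi fun _ : Edge d L => haarProbability G)) :=
        mul_le_mul_of_nonneg_left h hc.le
    _ = ∫ U, tiltW Φ U * ψ U ∂(Measure.pi fun _ : Edge d L => haarProbability G) := by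
        rw [← mul_assoc, ← Real.exp_add, neg_add_cancel, Real.exp_zero, one_mul]

omit [NeZero L] [TopologicalSpace G] [IsTopologicalGroup G] [CompactSpace G] [MeasurableSpace G]
  [BorelSpace G] [SecondCountableTopology G] in
/-- Symmetric form of the hypothesis: `|Φ(h ·ₑ U) − Φ(U)| ≤ C` implies the one-sided bound used by
the ENGINE. [folklore] -/
theorem le_add_of_abs_sub_le {Φ : GaugeConfig d L G → ℝ} {e : Edge d L} {C : ℝ}
    (hC : ∀ (h : G) (U : GaugeConfig d L G), |Φ (Pi.mulSingle e h * U) - Φ U| ≤ C)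
    (h : G) (U : GaugeConfig d L G) : Φ (Pi.mulSingle e h * U) ≤ Φ U + C := by
  have := (abs_le.1 (hC h U)).2
  linarith

end Engine

/-! ## §2 Separation, orthogonal innovations, Bessel's inequality -/

section Innovations

variable {d L : ℕ} [NeZero L] {G : Type*} [Group G] [TopologicalSpace G] [IsTopologicalGroup G]
  [CompactSpace G] [MeasurableSpace G] [BorelSpace G] [SecondCountableTopology G]
  [DecidableEq (Edge d L)] {Φ F : GaugeConfig d L G → ℝ}

/-- `∫ (F − a)·D_e^Φ F dπ_Φ = ∫ (D_e^Φ F)² dπ_Φ` for every constant `a` (orthogonality of the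
innovation to the fibre-constant function `K_e^Φ F − a`). -/
theorem integral_sub_const_mul_innovT (hΦ : Continuous Φ) (e : Edge d L) (hF : Continuous F)
    (a : ℝ) :
    ∫ U, (F U - a) * innovT Φ e F U ∂haarTilt Φ = ∫ U, (innovT Φ e F U) ^ 2 ∂haarTilt Φ := by
  haveI := isProbabilityMeasure_haarTilt hΦ
  have hK : Continuous (hbT Φ e F) := continuous_hbT hΦ e hF
  have horth := integral_sub_hbT_mul_eq_zero hΦ e (f := F) (g := fun U => hbT Φ e F U - a) hF
    (hK.sub continuous_const) (fun h U => by rw [hbT_mulSingle])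
  have hi1 : Integrable (fun U => (innovT Φ e F U) ^ 2) (haarTilt Φ) :=
    integrable_of_continuous_config ((continuous_innovT hΦ e hF).pow 2)
  have hi2 : Integrable (fun U => (F U - hbT Φ e F U) * (hbT Φ e F U - a)) (haarTilt Φ) :=
    integrable_of_continuous_config ((hF.sub hK).mul (hK.sub continuous_const))
  calc ∫ U, (F U - a) * innovT Φ e F U ∂haarTilt Φ
      = ∫ U, ((innovT Φ e F U) ^ 2 + (F U - hbT Φ e F U) * (hbT Φ e F U - a)) ∂haarTilt Φ := by
        refine integral_congr_ae (ae_of_all _ fun U => ?_); simp only [innovT]; ring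
    _ = ∫ U, (innovT Φ e F U) ^ 2 ∂haarTilt Φ
          + ∫ U, (F U - hbT Φ e F U) * (hbT Φ e F U - a) ∂haarTilt Φ := integral_add hi1 hi2
    _ = ∫ U, (innovT Φ e F U) ^ 2 ∂haarTilt Φ := by rw [horth, add_zero]

/-- **Separated links: `D_{e'}^Φ F` does not depend on the link `e`.**  If both the log-density `Φ`
and the observable `F` separate `e ≠ e'` (`f(h' ·_{e'} h ·ₑ U) = f(h' ·_{e'} U) + (f(h ·ₑ U) − f U)`),
then along the `e'`-fibre of `h ·ₑ U` the density shifts by a constant and `F` by a constant, so the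
shift rule applies. -/
theorem innovT_mulSingle_of_sep (hΦ : Continuous Φ) (hF : Continuous F) {e e' : Edge d L}
    (hΦsep : ∀ (h h' : G) (U : GaugeConfig d L G), Φ (Pi.mulSingle e' h' * (Pi.mulSingle e h * U))
      = Φ (Pi.mulSingle e' h' * U) + (Φ (Pi.mulSingle e h * U) - Φ U))
    (hFsep : ∀ (h h' : G) (U : GaugeConfig d L G), F (Pi.mulSingle e' h' * (Pi.mulSingle e h * U))
      = F (Pi.mulSingle e' h' * U) + (F (Pi.mulSingle e h * U) - F U))
    (h : G) (U : GaugeConfig d L G) :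
    innovT Φ e' F (Pi.mulSingle e h * U) = innovT Φ e' F U := by
  have hshift := hbT_eq_add hΦ e' hF (U := U) (V := Pi.mulSingle e h * U)
    (fun h' => hΦsep h h' U) (fun h' => hFsep h h' U)
  unfold innovT
  rw [hshift]
  ring

/-- **Innovations at separated links are orthogonal**: `∫ D_e^Φ F · D_{e'}^Φ F dπ_Φ = 0`. -/
theorem integral_innovT_mul_innovT_eq_zero (hΦ : Continuous Φ) (hF : Continuous F)
    {e e' : Edge d L}
    (hΦsep : ∀ (h h' : G) (U : GaugeConfig d L G), Φ (Pi.mulSingle e' h' * (Pi.mulSingle e h * U))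
      = Φ (Pi.mulSingle e' h' * U) + (Φ (Pi.mulSingle e h * U) - Φ U))
    (hFsep : ∀ (h h' : G) (U : GaugeConfig d L G), F (Pi.mulSingle e' h' * (Pi.mulSingle e h * U))
      = F (Pi.mulSingle e' h' * U) + (F (Pi.mulSingle e h * U) - F U)) :
    ∫ U, innovT Φ e F U * innovT Φ e' F U ∂haarTilt Φ = 0 :=
  integral_sub_hbT_mul_eq_zero hΦ e (f := F) (g := innovT Φ e' F) hF (continuous_innovT hΦ e' hF)
    (fun h U => innovT_mulSingle_of_sep hΦ hF hΦsep hFsep h U)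

/-- **BESSEL'S INEQUALITY for the innovations.**  For a finite family `M` of links pairwise
separated by `Φ` and by `F`, and every constant `a`:
`Σ_{e ∈ M} ∫ (D_e^Φ F)² dπ_Φ ≤ ∫ (F − a)² dπ_Φ` (the `D_e^Φ F` are pairwise orthogonal and each is
orthogonal to `F − a − D_e^Φ F`). -/
theorem sum_integral_innovT_sq_le (hΦ : Continuous Φ) (hF : Continuous F) (M : Finset (Edge d L))
    (hΦM : ∀ e ∈ M, ∀ e' ∈ M, e ≠ e' → ∀ (h h' : G) (U : GaugeConfig d L G),
      Φ (Pi.mulSingle e' h' * (Pi.mulSingle e h * U))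
        = Φ (Pi.mulSingle e' h' * U) + (Φ (Pi.mulSingle e h * U) - Φ U))
    (hFM : ∀ e ∈ M, ∀ e' ∈ M, e ≠ e' → ∀ (h h' : G) (U : GaugeConfig d L G),
      F (Pi.mulSingle e' h' * (Pi.mulSingle e h * U))
        = F (Pi.mulSingle e' h' * U) + (F (Pi.mulSingle e h * U) - F U))
    (a : ℝ) :
    ∑ e ∈ M, ∫ U, (innovT Φ e F U) ^ 2 ∂haarTilt Φ ≤ ∫ U, (F U - a) ^ 2 ∂haarTilt Φ := by
  haveI := isProbabilityMeasure_haarTilt hΦ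
  have hD : ∀ e : Edge d L, Continuous (innovT Φ e F) := fun e => continuous_innovT hΦ e hF
  have key : ∀ T : Finset (Edge d L), T ⊆ M →
      ∫ U, (F U - a - ∑ e ∈ T, innovT Φ e F U) ^ 2 ∂haarTilt Φ
        = ∫ U, (F U - a) ^ 2 ∂haarTilt Φ - ∑ e ∈ T, ∫ U, (innovT Φ e F U) ^ 2 ∂haarTilt Φ := by
    intro T
    induction T using Finset.induction_on with
    | empty => intro; simp
    | insert e T heT ih =>
      intro hsub
      have hTsub : T ⊆ M := fun x hx => hsub (Finset.mem_insert_of_mem hx)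
      have heM : e ∈ M := hsub (Finset.mem_insert_self _ _)
      have hR : Continuous fun U => F U - a - ∑ e' ∈ T, innovT Φ e' F U :=
        (hF.sub continuous_const).sub (continuous_finsetSum _ fun e' _ => hD e')
      have h0 : ∀ e' ∈ T, ∫ U, innovT Φ e' F U * innovT Φ e F U ∂haarTilt Φ = 0 :=
        fun e' he' => by
          have hne : e' ≠ e := fun hh => heT (hh ▸ he')
          exact integral_innovT_mul_innovT_eq_zero hΦ hF
            (hΦM e' (hTsub he') e heM hne) (hFM e' (hTsub he') e heM hne)
      have hcross : ∫ U, (F U - a - ∑ e' ∈ T, innovT Φ e' F U) * innovT Φ e F U ∂haarTilt Φ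
          = ∫ U, (innovT Φ e F U) ^ 2 ∂haarTilt Φ := by
        have hi1 : Integrable (fun U => (F U - a) * innovT Φ e F U) (haarTilt Φ) :=
          integrable_of_continuous_config ((hF.sub continuous_const).mul (hD e))
        have hi2 : Integrable (fun U => ∑ e' ∈ T, innovT Φ e' F U * innovT Φ e F U)
            (haarTilt Φ) :=
          integrable_finsetSum T (f := fun e' U => innovT Φ e' F U * innovT Φ e F U)
            fun e' _ => integrable_of_continuous_config ((hD e').mul (hD e))
        calc ∫ U, (F U - a - ∑ e' ∈ T, innovT Φ e' F U) * innovT Φ e F U ∂haarTilt Φ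
            = ∫ U, ((F U - a) * innovT Φ e F U
                - ∑ e' ∈ T, innovT Φ e' F U * innovT Φ e F U) ∂haarTilt Φ := by
              refine integral_congr_ae (ae_of_all _ fun U => ?_)
              simp only
              rw [sub_mul, Finset.sum_mul]
          _ = ∫ U, (F U - a) * innovT Φ e F U ∂haarTilt Φ
                - ∫ U, ∑ e' ∈ T, innovT Φ e' F U * innovT Φ e F U ∂haarTilt Φ :=
              integral_sub hi1 hi2
          _ = ∫ U, (innovT Φ e F U) ^ 2 ∂haarTilt Φ := by
              rw [integral_sub_const_mul_innovT hΦ e hF a,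
                integral_finsetSum T (f := fun e' U => innovT Φ e' F U * innovT Φ e F U)
                  fun e' _ => integrable_of_continuous_config ((hD e').mul (hD e)),
                Finset.sum_eq_zero h0, sub_zero]
      have hi1 : Integrable (fun U => (F U - a - ∑ e' ∈ T, innovT Φ e' F U) ^ 2) (haarTilt Φ) :=
        integrable_of_continuous_config (hR.pow 2)
      have hi2 : Integrable (fun U => 2 * ((F U - a - ∑ e' ∈ T, innovT Φ e' F U)
          * innovT Φ e F U)) (haarTilt Φ) :=
        (integrable_of_continuous_config (hR.mul (hD e))).const_mul 2
      have hi3 : Integrable (fun U => (innovT Φ e F U) ^ 2) (haarTilt Φ) :=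
        integrable_of_continuous_config ((hD e).pow 2)
      simp only [Finset.sum_insert heT]
      calc ∫ U, (F U - a - (innovT Φ e F U + ∑ e' ∈ T, innovT Φ e' F U)) ^ 2 ∂haarTilt Φ
          = ∫ U, ((F U - a - ∑ e' ∈ T, innovT Φ e' F U) ^ 2
              - 2 * ((F U - a - ∑ e' ∈ T, innovT Φ e' F U) * innovT Φ e F U)
              + (innovT Φ e F U) ^ 2) ∂haarTilt Φ := by
            refine integral_congr_ae (ae_of_all _ fun U => ?_); simp only; ring
        _ = ∫ U, (F U - a - ∑ e' ∈ T, innovT Φ e' F U) ^ 2 ∂haarTilt Φ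
              - ∫ U, 2 * ((F U - a - ∑ e' ∈ T, innovT Φ e' F U) * innovT Φ e F U) ∂haarTilt Φ
              + ∫ U, (innovT Φ e F U) ^ 2 ∂haarTilt Φ := by
            rw [integral_add (hi1.sub' hi2) hi3, integral_sub hi1 hi2]
        _ = ∫ U, (F U - a) ^ 2 ∂haarTilt Φ
              - (∫ U, (innovT Φ e F U) ^ 2 ∂haarTilt Φ
                  + ∑ e' ∈ T, ∫ U, (innovT Φ e' F U) ^ 2 ∂haarTilt Φ) := by
            rw [integral_const_mul, hcross, ih hTsub]; ring
  have hfin := key M subset_rfl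
  have hnonneg : 0 ≤ ∫ U, (F U - a - ∑ e ∈ M, innovT Φ e F U) ^ 2 ∂haarTilt Φ :=
    integral_nonneg fun U => sq_nonneg _
  linarith

/-- **Bessel against the variance**: `Σ_{e ∈ M} ∫ (D_e^Φ F)² dπ_Φ ≤ Var_{π_Φ}(F)`. -/
theorem sum_integral_innovT_sq_le_variance (hΦ : Continuous Φ) (hF : Continuous F)
    (M : Finset (Edge d L))
    (hΦM : ∀ e ∈ M, ∀ e' ∈ M, e ≠ e' → ∀ (h h' : G) (U : GaugeConfig d L G),
      Φ (Pi.mulSingle e' h' * (Pi.mulSingle e h * U))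
        = Φ (Pi.mulSingle e' h' * U) + (Φ (Pi.mulSingle e h * U) - Φ U))
    (hFM : ∀ e ∈ M, ∀ e' ∈ M, e ≠ e' → ∀ (h h' : G) (U : GaugeConfig d L G),
      F (Pi.mulSingle e' h' * (Pi.mulSingle e h * U))
        = F (Pi.mulSingle e' h' * U) + (F (Pi.mulSingle e h * U) - F U)) :
    ∑ e ∈ M, ∫ U, (innovT Φ e F U) ^ 2 ∂haarTilt Φ ≤ variance F (haarTilt Φ) := by
  rw [variance_eq_integral hF.aemeasurable]
  exact sum_integral_innovT_sq_le hΦ hF M hΦM hFM _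

end Innovations

/-! ## §3 The fibre variance bound and the one-link floor -/

section Floor

variable {d L : ℕ} [NeZero L] {G : Type*} [Group G] [TopologicalSpace G] [IsTopologicalGroup G]
  [CompactSpace G] [MeasurableSpace G] [BorelSpace G] [SecondCountableTopology G]
  [DecidableEq (Edge d L)] {Φ F : GaugeConfig d L G → ℝ}

/-- The fibre variance is at most the fibre mean square of the innovation:
`Q_e F (U) ≤ A_e ((D_e^Φ F)²)(U)` (a mean square about any constant dominates the variance; the
constant is the fibre-constant value of `K_e^Φ F`). -/
theorem sqDevT_le_linkAvg_innovT_sq (Φ : GaugeConfig d L G → ℝ) (e : Edge d L)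
    (hF : Continuous F) (U : GaugeConfig d L G) :
    sqDevT e F U ≤ linkAvg e (fun V => (innovT Φ e F V) ^ 2) U := by
  have hX : Continuous fun h : G => F (Pi.mulSingle e h * U) :=
    hF.comp (continuous_mulSingle_mul e U)
  obtain ⟨C, hC⟩ := WitnessColumn.exists_abs_le_of_continuous hX
  have h1 := WitnessColumn.integral_sub_const_sq (haarProbability G) hX.measurable hC
    (linkAvg e F U)
  have h2 := WitnessColumn.integral_sub_const_sq (haarProbability G) hX.measurable hC
    (hbT Φ e F U)
  have hmean : ∫ h, F (Pi.mulSingle e h * U) ∂haarProbability G = linkAvg e F U := rfl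
  unfold sqDevT linkAvg
  simp only [innovT, hbT_mulSingle]
  unfold linkAvg at h1 hmean
  rw [h1, h2, hmean]
  nlinarith [sq_nonneg ((∫ h, F (Pi.mulSingle e h * U) ∂haarProbability G) - hbT Φ e F U)]

/-- **ONE-LINK FLOOR.**  If replacing the link `e` raises `Φ` by at most `C_e` and replacing `e⋆`
by at most `C_{e⋆}`, then
`e^{−C_e} · e^{−C_{e⋆}} · ∫ A_{e⋆} Q_e F dπ_Φ ≤ ∫ (D_e^Φ F)² dπ_Φ`
(ENGINE at `e⋆`, the fibre variance bound, ENGINE at `e`). -/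
theorem integral_innovT_sq_ge (hΦ : Continuous Φ) (hF : Continuous F) (e estar : Edge d L)
    {Ce Cs : ℝ}
    (hCe : ∀ (h : G) (U : GaugeConfig d L G), Φ (Pi.mulSingle e h * U) ≤ Φ U + Ce)
    (hCs : ∀ (h : G) (U : GaugeConfig d L G), Φ (Pi.mulSingle estar h * U) ≤ Φ U + Cs) :
    Real.exp (-Ce) * (Real.exp (-Cs) * ∫ U, linkAvg estar (sqDevT e F) U ∂haarTilt Φ)
      ≤ ∫ U, (innovT Φ e F U) ^ 2 ∂haarTilt Φ := by
  haveI := isProbabilityMeasure_haarTilt hΦ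
  have hQ := continuous_sqDevT e hF (G := G)
  have hD2 : Continuous fun V => (innovT Φ e F V) ^ 2 := (continuous_innovT hΦ e hF).pow 2
  -- ENGINE at `e⋆` for `ψ = Q_e F`
  have h3 := exp_neg_mul_integral_linkAvg_le hΦ estar hCs hQ (sqDevT_nonneg e F)
  -- `∫ Q_e F ≤ ∫ A_e ((D_e F)²)`
  have h2 : ∫ U, sqDevT e F U ∂haarTilt Φ
      ≤ ∫ U, linkAvg e (fun V => (innovT Φ e F V) ^ 2) U ∂haarTilt Φ :=
    integral_mono (integrable_of_continuous_config hQ)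
      (integrable_of_continuous_config (continuous_linkAvg e hD2))
      fun U => sqDevT_le_linkAvg_innovT_sq Φ e hF U
  -- ENGINE at `e` for `ψ = (D_e F)²`
  have h1 := exp_neg_mul_integral_linkAvg_le hΦ e hCe hD2 fun U => sq_nonneg _
  have hc : 0 ≤ Real.exp (-Ce) := (Real.exp_pos _).le
  calc Real.exp (-Ce) * (Real.exp (-Cs) * ∫ U, linkAvg estar (sqDevT e F) U ∂haarTilt Φ)
      ≤ Real.exp (-Ce) * ∫ U, linkAvg e (fun V => (innovT Φ e F V) ^ 2) U ∂haarTilt Φ :=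
        mul_le_mul_of_nonneg_left (h3.trans h2) hc
    _ ≤ ∫ U, (innovT Φ e F U) ^ 2 ∂haarTilt Φ := h1

end Floor

end Summit.Ventures.LatticeQCDFlow.Theory2.DefectFloor
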